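import Summits.QuantumFields.YangMills.Theorems.LuscherReductionDressedRitzOfOperatorPlateau
import Summits.QuantumFields.YangMills.Theorems.LuscherReductionDressedRitzPlateauCertificates
import Summits.QuantumFields.YangMills.Theorems.FemtoTransferGapGroundState
import HarnessLib

/-!
# Route `LuscherReduction`, item `DressedRitz` (stmt-QuantumFields-20205) — reduction chain, file 6: NON-VACUITY of the operator-language cut —
# `RunningReduction → OneSiteLevels → ∀ k, OperatorPlateauAt k` (and `OrthoPlateauAt k`), ONE-free since crux ONE is closed

Support module of the `FemtoTransferGap` group (fleet service by seat ym-infvol-p2 g6; route `LuscherReduction`, femto rung R2b1; bears on the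
crux child `DressedRitz` = stmt-QuantumFields-20205 of RED `RunningReduction` stmt-QuantumFields-19978).  CONTENT = §4 of the planner's crux workfile
`Summits/QuantumFields/YangMills/Cruxes/RunningReduction/Lines/OperatorPlateau.lean` (rev 2, seat ym-cruxidea-19978-1 GEN 6; kernel-checked there,
farm rc 0) RE-HOMED on the Theorems side (cuts ↦ `∀ k`, their `k`-slices of `…DressedRitzPlateauDefs.lean`; proofs VERBATIM; the two §8 lemmas it
copied from `DressedRitzGEVP.lean` are taken from `…DressedRitzPlateauCertificates.lean` instead of being duplicated).

Witnesses: vacuum = the Perron–Frobenius ground state `Ω ≥ c > 0` (`PhysL2.exists_groundState`), insertions `O_i := φ_{i+1}/Ω` (physical by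
`isPhys_div`) built from the exact excited eigenfamily, for which `ins Ω O_i = φ_{i+1}` EXACTLY because excited eigenfunctions are `⟂ Ω` (`K_β`
symmetric, `λ_{i+1} ≤ λ₁ < λ₀`, `levelValue_one_lt_levelValue_zero`).  With crux ONE closed (`oneSiteLevels_proof`), the operator cut is implied by
RED ALONE: `RunningReduction → ∀ k, OperatorPlateauAt k → … → DressedRitz` — satisfiable exactly when RED holds; a genuine re-expression of item
20205, not a strengthening.

* `plateauClauses_of_eigen` (the homogeneous clauses for the exact excited eigenfamily, given RED at levels `≤ k` and the level-`k` spread),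
  `exists_eigen_plateauClauses` (deep window, RED ∧ ONE ⇒ such an eigenfamily with `C' = |C_RED| + |Δ_k| + |C_ONE|`),
  ★ `orthoPlateau_of_runningReduction_oneSiteLevels : RED → ONE → ∀ k, OrthoPlateauAt k`,
  ★ `operatorPlateau_of_runningReduction_oneSiteLevels : RED → ONE → ∀ k, OperatorPlateauAt k`;
  ONE-free: ★ `orthoPlateau_of_runningReduction`, ★ `operatorPlateau_of_runningReduction : RunningReduction → ∀ k, OperatorPlateauAt k`.

HONEST FRAMING: fixed-lattice linear algebra on the femto rung R2b1; proves nothing OF RED ∕ `DressedRitz`; no bearing on infinite volume, the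
continuum limit or the Clay mass gap.  References: Reed–Simon IV, Thm. XIII.1 [cite: ReedSimonIV1978, Thm. XIII.1]; Lüscher–Wolff (operator bases)
[cite: LuscherWolff1990].
-/

set_option autoImplicit false

noncomputable section

open MeasureTheory Filter Topology Real
open Literature.MathematicalPhysics.QuantumFieldTheory
open Literature.MathematicalPhysics.QuantumLattice
open Literature.Analysis.OperatorTheory.YMMatrixModel
open scoped BigOperators

namespace Summit.QuantumFields.YangMills.Theorems.FemtoTransferGap.OpPlat

open Summit.QuantumFields.YangMills.Theorems.FemtoTransferGap
open Summit.QuantumFields.YangMills.Theorems.FemtoTransferGap.KTRCalibration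
open Summit.QuantumFields.YangMills.Theorems.FemtoTransferGap.PhysL2
open Summit.QuantumFields.YangMills.Theorems.FemtoTransferGap.KTGen

/-! ## §4 NON-VACUITY: `RunningReduction → OneSiteLevels → ∀ k, OperatorPlateauAt k` (and `→ OrthoPlateauAt k`) -/

section Certificate
variable {L : ℕ} [NeZero L]

/-- The homogeneous clauses hold for the EXACT excited eigenfamily `u_i := φ_{i+1}` (`l2`-orthonormal, `K_βφ_j = λ_jφ_j`), given RED at levels
`j ≤ k` with a constant `C₁ ≤ C` and the level-`k` spread `λ₀ − λ_k ≤ C(λ/L)λ₀`: (o2), (o4), (o6) with value `0`, (o1) by `levelValue_antitone`,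
(o5) = RED, (o7) from the spread. [cite: ReedSimonIV1978, Thm. XIII.1] -/
theorem plateauClauses_of_eigen {k : ℕ} {C₁ C : ℝ} {β : ℝ} (hβ : 0 ≤ β) (hC0 : 0 ≤ C) (hCC : C₁ ≤ C)
    {φ : Fin (k + 1) → (GaugeConfig 3 L SU2 → ℝ)}
    (hon : ∀ i l, l2 (φ i) (φ l) = if i = l then 1 else 0)
    (heig : ∀ i, transferApply β (φ i) = levelValue su2Rep L β i • φ i)
    (hRED : ∀ j : ℕ, j ≤ k →
      levelValue su2Rep L β j * levelValue su2Rep 1 (oneSiteCoupling β L) 0 ≤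
          Real.exp (C₁ * luscherLambda β L ^ 2 / L) * (levelValue su2Rep 1 (oneSiteCoupling β L) j * levelValue su2Rep L β 0) ∧
        levelValue su2Rep 1 (oneSiteCoupling β L) j * levelValue su2Rep L β 0 ≤
          Real.exp (C₁ * luscherLambda β L ^ 2 / L) * (levelValue su2Rep L β j * levelValue su2Rep 1 (oneSiteCoupling β L) 0))
    (hsp : levelValue su2Rep L β 0 - levelValue su2Rep L β k ≤ C * (luscherLambda β L / L) * levelValue su2Rep L β 0) :
    PlateauClauses k C β (fun i : Fin k => φ i.succ) := by
  have hB : 0 ≤ oneSiteCoupling β L := oneSiteCoupling_nonneg β L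
  have hlam_nn : 0 ≤ luscherLambda β L := luscherLambda_nonneg β L
  have hLnn : (0 : ℝ) ≤ (L : ℝ) := Nat.cast_nonneg L
  have ht2 : 0 ≤ luscherLambda β L ^ 2 / L := div_nonneg (sq_nonneg _) hLnn
  have ht3 : 0 ≤ luscherLambda β L ^ 3 / (L : ℝ) ^ 2 := div_nonneg (pow_nonneg hlam_nn 3) (sq_nonneg _)
  have hlv0 : 0 ≤ levelValue su2Rep L β 0 := levelValue_su2Rep_nonneg L hβ 0
  have hd : ∀ a b : Fin (k + 1), l2 (φ a) (transferApply β (φ b)) = if a = b then levelValue su2Rep L β b else 0 :=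
    fun a b => by rw [← qform_eq_l2_transferApply, qform_of_eigen_orthonormal hon heig]
  have hKK : ∀ a : Fin (k + 1), l2 (transferApply β (φ a)) (transferApply β (φ a)) = levelValue su2Rep L β a ^ 2 := fun a => by
    rw [heig a, l2_smul_smul, hon a a, if_pos rfl, mul_one, sq]
  have hsucc_le : ∀ i : Fin k, (i : ℕ) + 1 ≤ k := fun i => Nat.succ_le_of_lt i.2
  have hsqrt_nn : ∀ a b : Fin (k + 1), 0 ≤ Real.sqrt (l2 (φ a) (φ a)) * Real.sqrt (l2 (φ b) (φ b)) :=
    fun a b => mul_nonneg (Real.sqrt_nonneg _) (Real.sqrt_nonneg _)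
  refine ⟨fun i => ?_, fun i l hil => ?_, fun i l hil => ?_, fun i => ?_, fun i => ?_, fun i l hil => ?_, fun i => ?_⟩
  · -- (o0)
    rw [hon, if_pos rfl]; exact one_pos
  · -- (o1) sorted: `λ_{l+1} ≤ λ_{i+1}`
    rw [hd, if_pos rfl, hd, if_pos rfl, hon, if_pos rfl, hon, if_pos rfl, mul_one, mul_one]
    exact levelValue_antitone hβ (Fin.le_def.mp (Fin.succ_le_succ_iff.mpr hil))
  · -- (o2) exact orthogonality
    have hne : i.succ ≠ l.succ := fun h => hil (Fin.succ_injective _ h)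
    rw [hon, if_neg hne, abs_zero]
    exact mul_nonneg (mul_nonneg hC0 hlam_nn) (hsqrt_nn _ _)
  · -- (o4) zero residual
    rw [hKK, hd, if_pos rfl, hon, if_pos rfl, mul_one, sub_self, one_pow, mul_one]
    exact mul_nonneg (mul_nonneg hC0 ht3) (sq_nonneg _)
  · -- (o5) = RED at level `i+1 ≤ k`
    rw [hd, if_pos rfl, hon, if_pos rfl, mul_one, mul_one, Fin.val_succ]
    obtain ⟨ha, hb⟩ := hRED ((i : ℕ) + 1) (hsucc_le i)
    have hY₁ : 0 ≤ levelValue su2Rep 1 (oneSiteCoupling β L) ((i : ℕ) + 1) * levelValue su2Rep L β 0 :=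
      mul_nonneg (levelValue_su2Rep_nonneg 1 hB _) hlv0
    have hY₂ : 0 ≤ levelValue su2Rep L β ((i : ℕ) + 1) * levelValue su2Rep 1 (oneSiteCoupling β L) 0 :=
      mul_nonneg (levelValue_su2Rep_nonneg L hβ _) (levelValue_su2Rep_nonneg 1 hB 0)
    exact ⟨le_exp_mul_div_of_le ha ht2 hY₁ hCC, le_exp_mul_div_of_le hb ht2 hY₂ hCC⟩
  · -- (o6) zero couplings
    have hne : i.succ ≠ l.succ := fun h => hil (Fin.succ_injective _ h)
    rw [hd, if_neg hne, hon i.succ l.succ, if_neg hne, mul_zero, sub_zero, abs_zero]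
    exact mul_nonneg (mul_nonneg (mul_nonneg hC0 ht2) hlv0) (hsqrt_nn _ _)
  · -- (o7) spread at level `i+1 ≤ k`
    rw [hd, if_pos rfl, hon, if_pos rfl, mul_one, mul_one, Fin.val_succ]
    have hmono : levelValue su2Rep L β k ≤ levelValue su2Rep L β ((i : ℕ) + 1) := levelValue_antitone hβ (hsucc_le i)
    linarith


/-- In the deep window, under RED ∧ ONE: the exact eigenfamily `φ₀ … φ_k` exists (`λ_k > 0`) and `u_i := φ_{i+1}` satisfies `PlateauClauses`
with the constant `C' := |C_RED| + |Δ_k| + |C_ONE|`.  (The common core of the two certificates below; §10 of `Lines/DressedRitzGEVP.lean`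
re-organised; `oneSiteCoupling_ge_of_small_level` / `spread_le_of_red_one` from `…DressedRitzPlateauCertificates.lean`.)
[cite: ReedSimonIV1978, Thm. XIII.1] -/
theorem exists_eigen_plateauClauses {k : ℕ} {C Ck B0 lam0 lam : ℝ}
    (hC : ∀ lam : ℝ, 0 < lam → lam ≤ lam0 → ∃ L0 : ℕ, ∀ (L : ℕ) [NeZero L], L0 ≤ L → ∀ β : ℝ,
      InFemtoWindow lam β L → ∀ j : ℕ, j ≤ k →
        levelValue su2Rep L β j * levelValue su2Rep 1 (oneSiteCoupling β L) 0 ≤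
            Real.exp (C * luscherLambda β L ^ 2 / L) * (levelValue su2Rep 1 (oneSiteCoupling β L) j * levelValue su2Rep L β 0) ∧
          levelValue su2Rep 1 (oneSiteCoupling β L) j * levelValue su2Rep L β 0 ≤
            Real.exp (C * luscherLambda β L ^ 2 / L) * (levelValue su2Rep L β j * levelValue su2Rep 1 (oneSiteCoupling β L) 0))
    (hB0 : ∀ B : ℝ, B0 ≤ B → 0 < levelValue su2Rep 1 B 0 ∧
      levelValue su2Rep 1 B k ≤ Real.exp (-(levelGap k * bareLambda B - Ck * bareLambda B ^ 2)) * levelValue su2Rep 1 B 0 ∧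
      Real.exp (-(levelGap k * bareLambda B + Ck * bareLambda B ^ 2)) * levelValue su2Rep 1 B 0 ≤ levelValue su2Rep 1 B k)
    (hlam : 0 < lam) (hle : lam ≤ min lam0 (min (1 / 2) (1 / (4 * max B0 1)))) :
    ∃ L0 : ℕ, ∀ (L : ℕ) [NeZero L], L0 ≤ L → ∀ β : ℝ, InFemtoWindow lam β L →
      ∃ φ : Fin (k + 1) → (GaugeConfig 3 L SU2 → ℝ), (∀ i, IsPhys (φ i)) ∧
        (∀ i l, l2 (φ i) (φ l) = if i = l then 1 else 0) ∧
        (∀ i, transferApply β (φ i) = levelValue su2Rep L β i • φ i) ∧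
        PlateauClauses k (|C| + |levelGap k| + |Ck|) β (fun i : Fin k => φ i.succ) := by
  have hCC' : C ≤ |C| + |levelGap k| + |Ck| := by
    linarith [le_abs_self C, abs_nonneg (levelGap k), abs_nonneg Ck]
  have hC'0 : 0 ≤ |C| + |levelGap k| + |Ck| := by positivity
  obtain ⟨L0, hL⟩ := hC lam hlam (hle.trans (min_le_left _ _))
  refine ⟨L0, fun L _ hL0 β hW => ?_⟩
  have hlam_half : lam ≤ 1 / 2 := (hle.trans (min_le_right _ _)).trans (min_le_left _ _)
  have hlam1 : lam ≤ 1 := hlam_half.trans (by norm_num)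
  have hlamB : lam ≤ 1 / (4 * max B0 1) := (hle.trans (min_le_right _ _)).trans (min_le_right _ _)
  have hβ : (0 : ℝ) ≤ β := zero_le_one.trans hW.1
  have hlam_nn : 0 ≤ luscherLambda β L := luscherLambda_nonneg β L
  have hlpos : 0 < luscherLambda β L := luscherLambda_pos_of_window hlam hW
  have hΛ1 : luscherLambda β L ≤ 1 := by linarith [hW.2.2]
  have hL1 : (1 : ℝ) ≤ (L : ℝ) := by exact_mod_cast NeZero.one_le
  have hlv0 : 0 ≤ levelValue su2Rep L β 0 := levelValue_su2Rep_nonneg L hβ 0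
  -- positivity of `λ_k`, then spectral attainment of the levels `0 … k`
  have hk : 0 < levelValue su2Rep L β k :=
    levelValue_pos_of_red_one hlam hlam1 hlamB hW (fun B hB => ⟨(hB0 B hB).1, (hB0 B hB).2.2⟩)
      (hL L hL0 β hW k le_rfl).2
  obtain ⟨φ, hφ, hon, heig⟩ := exists_isPhys_eigenfamily hβ k hk
  -- the level-`k` spread from the lower laws of RED ∧ ONE
  have hsp : levelValue su2Rep L β 0 - levelValue su2Rep L β k
      ≤ (|C| + |levelGap k| + |Ck|) * (luscherLambda β L / L) * levelValue su2Rep L β 0 := by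
    have hB0le : B0 ≤ oneSiteCoupling β L := oneSiteCoupling_ge_of_small_level hlam hlam1 hlamB hW
    obtain ⟨hμ0, -, hlow⟩ := hB0 _ hB0le
    rw [bareLambda_oneSiteCoupling hlpos] at hlow
    exact spread_le_of_red_one hμ0 hlv0 hlam_nn hΛ1 hL1 hlow (hL L hL0 β hW k le_rfl).2
  exact ⟨φ, hφ, hon, heig, plateauClauses_of_eigen hβ hC'0 hCC' hon heig (fun j hj => hL L hL0 β hW j hj) hsp⟩

omit [NeZero L] in
/-- ★ **NON-VACUITY of the homogeneous cut: `RunningReduction → OneSiteLevels → ∀ k, OrthoPlateauAt k`** (vacuum `φ₀`, vectors `φ_{i+1}`).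
[cite: ReedSimonIV1978, Thm. XIII.1] -/
theorem orthoPlateau_of_runningReduction_oneSiteLevels
    (hRED : Summit.QuantumFields.YangMills.Theses.LuscherReduction.RunningReduction)
    (hONE : Summit.QuantumFields.YangMills.Theses.LuscherReduction.OneSiteLevels) :
    ∀ k : ℕ, OrthoPlateauAt k := by
  intro k
  obtain ⟨C, lam0, hlam0, hC⟩ := runningReduction_uniform hRED k
  obtain ⟨Ck, B0, hB0⟩ := hONE k
  refine ⟨|C| + |levelGap k| + |Ck|, min lam0 (min (1 / 2) (1 / (4 * max B0 1))), by positivity,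
    lt_min hlam0 (lt_min (by norm_num) (by positivity)), fun lam hlam hle => ?_⟩
  obtain ⟨L0, hL⟩ := exists_eigen_plateauClauses hC hB0 hlam hle
  refine ⟨L0, fun L _ hL0 β hW => ?_⟩
  obtain ⟨φ, hφ, hon, heig, hcl⟩ := hL L hL0 β hW
  refine ⟨φ 0, hφ 0, ?_, ?_, fun i => φ i.succ, fun i => hφ i.succ, fun i => ?_, hcl⟩
  · rw [hon 0 0, if_pos rfl]
  · rw [heig 0, Fin.val_zero]
  · rw [hon 0 i.succ, if_neg (Fin.succ_ne_zero i).symm]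

omit [NeZero L] in
/-- ★ **NON-VACUITY of the operator cut: `RunningReduction → OneSiteLevels → ∀ k, OperatorPlateauAt k`.**  Vacuum: the Perron–Frobenius ground state
`Ω ≥ c > 0` (`PhysL2.exists_groundState`); insertions `O_i := φ_{i+1}/Ω` (physical by `isPhys_div`), for which `ins Ω O_i = φ_{i+1}` EXACTLY,
because excited eigenfunctions are orthogonal to `Ω` (`K_β` symmetric, `λ_{i+1} ≤ λ₁ < λ₀`, `levelValue_one_lt_levelValue_zero`).
So the operator-language cut is implied by the route's two cruxes. [cite: ReedSimonIV1978, Thm. XIII.1] -/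
theorem operatorPlateau_of_runningReduction_oneSiteLevels
    (hRED : Summit.QuantumFields.YangMills.Theses.LuscherReduction.RunningReduction)
    (hONE : Summit.QuantumFields.YangMills.Theses.LuscherReduction.OneSiteLevels) :
    ∀ k : ℕ, OperatorPlateauAt k := by
  intro k
  obtain ⟨C, lam0, hlam0, hC⟩ := runningReduction_uniform hRED k
  obtain ⟨Ck, B0, hB0⟩ := hONE k
  refine ⟨|C| + |levelGap k| + |Ck|, min lam0 (min (1 / 2) (1 / (4 * max B0 1))), by positivity,
    lt_min hlam0 (lt_min (by norm_num) (by positivity)), fun lam hlam hle => ?_⟩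
  obtain ⟨L0, hL⟩ := exists_eigen_plateauClauses hC hB0 hlam hle
  refine ⟨L0, fun L _ hL0 β hW => ?_⟩
  obtain ⟨φ, hφ, hon, heig, hcl⟩ := hL L hL0 β hW
  have hβ : (0 : ℝ) ≤ β := zero_le_one.trans hW.1
  -- the Perron–Frobenius vacuum
  obtain ⟨Ω, θ, c, hΩ, hc, hcle, hΩ1, hKΩ, -, -, -⟩ := exists_groundState (L := L) β
  rw [← levelValue_zero] at hKΩ
  have hΩne : ∀ U, Ω U ≠ 0 := fun U => (hc.trans_le (hcle U)).ne'
  -- excited eigenfunctions are orthogonal to the vacuum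
  have hperp : ∀ i : Fin k, l2 Ω (φ i.succ) = 0 := by
    intro i
    have h1 : l2 (transferApply β Ω) (φ i.succ) = l2 Ω (transferApply β (φ i.succ)) := l2_transferApply_comm β hΩ (hφ _)
    rw [hKΩ, heig, l2_smul_left, l2_smul_right] at h1
    have hlt : levelValue su2Rep L β i.succ < levelValue su2Rep L β 0 :=
      lt_of_le_of_lt (levelValue_antitone hβ (by rw [Fin.val_succ]; exact Nat.le_add_left 1 _))
        (levelValue_one_lt_levelValue_zero β)
    have h2 : (levelValue su2Rep L β 0 - levelValue su2Rep L β i.succ) * l2 Ω (φ i.succ) = 0 := by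
      rw [sub_mul, h1, sub_self]
    exact (mul_eq_zero.mp h2).resolve_left (sub_ne_zero.mpr hlt.ne')
  have hins : (fun i : Fin k => ins Ω (φ i.succ / Ω)) = fun i : Fin k => φ i.succ := by
    funext i
    rw [ins_div hΩne, hperp i, zero_smul, sub_zero]
  refine ⟨Ω, hΩ, hΩ1, hKΩ, fun i => φ i.succ / Ω, fun i => isPhys_div (hφ _) hΩ hc hcle, ?_⟩
  show PlateauClauses k (|C| + |levelGap k| + |Ck|) β (fun i : Fin k => ins Ω (φ i.succ / Ω))
  rw [hins]
  exact hcl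

omit [NeZero L] in
/-- ★ With crux ONE closed in the tree (`oneSiteLevels_proof`): **`RunningReduction → ∀ k, OrthoPlateauAt k`**. [cite: ReedSimonIV1978, Thm. XIII.1] -/
theorem orthoPlateau_of_runningReduction
    (hRED : Summit.QuantumFields.YangMills.Theses.LuscherReduction.RunningReduction) : ∀ k : ℕ, OrthoPlateauAt k :=
  orthoPlateau_of_runningReduction_oneSiteLevels hRED oneSiteLevels_proof

omit [NeZero L] in
/-- ★ With crux ONE closed in the tree (`oneSiteLevels_proof`): **`RunningReduction → ∀ k, OperatorPlateauAt k`** — the operator-language cut is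
implied by RED alone, i.e. it is EXACTLY as strong as what it feeds (`OperatorPlateauAt → … → DressedRitz`, and RED ⟹ DressedRitz ⟹̸ RED).
[cite: ReedSimonIV1978, Thm. XIII.1] -/
theorem operatorPlateau_of_runningReduction
    (hRED : Summit.QuantumFields.YangMills.Theses.LuscherReduction.RunningReduction) : ∀ k : ℕ, OperatorPlateauAt k :=
  operatorPlateau_of_runningReduction_oneSiteLevels hRED oneSiteLevels_proof

end Certificate

end Summit.QuantumFields.YangMills.Theorems.FemtoTransferGap.OpPlat

end
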